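import Mathlib.LinearAlgebra.Dimension.Constructions
import Mathlib.LinearAlgebra.Dimension.Finite
import Mathlib.LinearAlgebra.Dimension.Free
import Mathlib.LinearAlgebra.LinearIndependent.Lemmas
import Literature.AlgebraicGeometry.HodgeTheory.WeilClasses
import Literature.AlgebraicGeometry.HodgeTheory.GysinFormalism
import Literature.AlgebraicGeometry.HodgeTheory.RationalHodgeClasses
import Literature.AlgebraicGeometry.Motives.WeilDiscriminant
import Literature.Geometry.Kaehler.LefschetzOperator
import HarnessLib

/-!
# Hyperbolic Weil type: a `K`-stable Lagrangian rational `2n`-frame in `H¹(A(ℂ); ℂ)`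

Let `(X, K, E)` be a polarized abelian variety of Weil type of dimension `2n` (`K = ℚ(√-d) ↪ End⁰(X)`
acting on `H^{1,0}` with multiplicities `(n, n)`, `E` a polarization with `(√-d)^* E = d E`). Van
Geemen, *An introduction to the Hodge conjecture for abelian varieties*, LNM 1594 (1994), Lemma 5.2:
`H(x, y) := E(x, (√-d)·y) + √-d · E(x, y)` is a non-degenerate Hermitian form of signature `(n, n)` on
the `2n`-dimensional `K`-vector space `H₁(X, ℚ)`, and `det H ∈ ℚ^× / Nm(K^×)` is an isogeny invariant
of `(X, K, E)` (the *discriminant*; Markman, arXiv:2502.03415, §1.1: the invariant `(n, K, det H)` of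
a component of the moduli space of polarized abelian `2n`-folds of Weil type). By Landherr's
classification (van Geemen 5.4, (5.4.1)): in a suitable `K`-basis
`H = a·z̄₁w₁ + z̄₂w₂ + ⋯ + z̄ₙwₙ − (z̄ₙ₊₁wₙ₊₁ + ⋯ + z̄₂ₙw₂ₙ)`, `a ∈ ℚ_{>0}`, `det H = (-1)ⁿ a`. The form
`H` is **hyperbolic** (an orthogonal sum of `n` hyperbolic planes) iff `a ∈ Nm(K^×)`, i.e. iff
`det H = (-1)ⁿ` in `ℚ^× / Nm(K^×)`, iff its Witt index is `n`, iff `H₁(X, ℚ)` contains a `K`-subspace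
`W` of `K`-dimension `n` with `H|_W = 0`. These are the "hyperbolic components" of the Weil locus —
the ones with a `0`-dimensional rational boundary component (totally degenerate cusp); e.g. Markman's
`X × X̂` has `det H = (-1)ⁿ` (arXiv:2502.03415, Lemma 3.1.3).

This file renders hyperbolicity on the REAL CARRIERS of the tree — complex Betti cohomology
`complexBetti A.X k = Hᵏ(A(ℂ); ℂ)` of `A : AbelianVariety ℂ`, pull-backs `complexBetti.map` along an
endomorphism `φ : A ⟶ A` (playing `√-d`), rational classes `HodgeTheory.IsRationalClass`, the cup
product and a polarization CLASS `h ∈ H²(A(ℂ); ℂ)` — exactly as its sibling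
`Literature/AlgebraicGeometry/HodgeTheory/WeilClasses` renders the Weil plane:

* `polarizationPairingOne X h j (x, y) := hʲ ⌣ (x ⌣ y) ∈ H^{2+2j}(X(ℂ); ℂ)` for `x, y ∈ H¹(X(ℂ); ℂ)`
  (the Lefschetz iterate `Literature.Geometry.Kaehler.lefschetzPow h j 2` of the cup product; for
  `X = A` of dimension `g` and `j = g - 1` this is the Hodge–Riemann / polarization pairing of `h` on
  `H¹`, valued in the top cohomology `H^{2g}(A(ℂ); ℂ) ≅ ℂ`);
* `IsHyperbolicWeilType A φ n h`: **there are `2n` rational, `ℂ`-linearly independent classes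
  `u₁, …, u₂ₙ ∈ H¹(A(ℂ); ℂ)` whose span is `φ^*`-stable and which are pairwise isotropic:
  `h^{2n-1} ⌣ (uᵢ ⌣ uⱼ) = 0`** — a `K`-stable rational Lagrangian `2n`-frame of `H¹` for the
  polarization pairing (the literal shape already used by the route `WeilConeBoundary` of the Hodge
  summit, there inlined ad hoc).

## Why this is van Geemen's hyperbolicity (dictionary, for `A.dim = 2n`, `φ ≫ φ = -d`, `h = cl(E)`)

Write `V = H₁(A, ℚ)` (`dim_ℚ V = 4n`), `V^* = H¹(A, ℚ)`, `ι : V ≅ V^*`, `x ↦ E(x, ·)`, and `E^*` for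
the form on `V^*` transported along `ι`. (1) For a `K`-subspace `W ⊆ V` (i.e. a `φ_*`-stable
`ℚ`-subspace, `K = ℚ + ℚ φ_*`): `H|_W = 0 ⟺ E|_W = 0`, because `H(x, y) = E(x, φ_* y) + √-d·E(x, y)`
with `E(x, φ_* y), E(x, y) ∈ ℚ` and `1, √-d` independent over `ℚ` (`forall_weilHermitianForm_eq_zero_iff`
below, on the abstract form of `Motives/WeilDiscriminant`); a `K`-subspace of `K`-dimension `n` is a
`ℚ`-subspace of dimension `2n = ½ dim_ℚ V`, so "Witt index `n`" ⟺ "`V` contains a `φ_*`-stable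
`E`-Lagrangian `ℚ`-subspace of dimension `2n`" (van Geemen 5.2 (2), 5.4). (2) `W ↦ Ann(W) ⊆ V^*` is a
bijection between `φ_*`-stable `E`-Lagrangian subspaces of `V` and `φ^*`-stable `E^*`-Lagrangian
subspaces of `V^*` (`φ^*` is the transpose of `φ_*`; `Ann(W) = ι(W^{⊥_E}) = ι(W)` for `W`
Lagrangian). (3) `H^*(A, ℚ) = ⋀^* H¹(A, ℚ)` with the cup product as wedge (Birkenhake–Lange,
Lemma 1.1.17, Cor. 1.1.18) and `h = cl(E) = -Σ dᵥ dxᵥ ∧ dyᵥ` in a symplectic basis (loc. cit.,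
Thm. 1.2.4, Lemma 1.7.4, `E` of type `(d₁, …, d_g)`); computing in that basis,
`Q_h(x, y) := h^{g-1} ⌣ x ⌣ y = c · E^*(x, y) · vol` with `c = (-1)^{g-1} (g-1)! d₁⋯d_g ≠ 0`
(equivalently `Q_h = -(1/g) · E^* · h^g`; as it must be, both sides being `Sp(E)`-invariant pairings
on the irreducible `V^*`). Hence, for `h` a polarization (`E` non-degenerate, `h^{2n} ≠ 0`, so `Q_h`
is a non-degenerate alternating form on the `4n`-dimensional `H¹` and "isotropic of dimension `2n`"
means Lagrangian) the `Q_h`-isotropic `φ^*`-stable `2n`-dimensional rational subspaces of `H¹` are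
exactly the `Ann(W)`, and `IsHyperbolicWeilType A φ n h ⟺ H` is hyperbolic
`⟺ det H = (-1)ⁿ ∈ ℚ^×/Nm(K^×)`. (4) "Rational subspace of dimension `2n`" is rendered as the
`ℂ`-span of `2n` rational, `ℂ`-independent classes; by
`HodgeTheory.linearIndependent_iff_of_isRationalClass` (`Hᵏ(ℚ) ⊗ ℂ ↪ Hᵏ(ℂ)`) `ℂ`- and
`ℚ`-independence of rational classes agree (so the rational class `φ^* uᵢ` lies in the `ℚ`-span of
the `uⱼ` as soon as it lies in their `ℂ`-span), and `isHyperbolicWeilType_iff_exists_submodule` gives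
the basis-free form (a `φ^*`-stable isotropic `ℂ`-subspace of dimension `2n` spanned by its rational
classes).

## Design

* The polarization class `h` is an ARGUMENT: `det H`, hence hyperbolicity, is an invariant of the
  polarized triple `(X, K, E)` (van Geemen 5.2 (3); Markman §1.1 "`(A, η, h)`"), not of `(X, K)` — only
  for the general member is the Weil-compatible polarization unique up to `ℚ^×` (van Geemen, proof of
  5.2 (1)); rescaling `h ↦ c h`, `c ≠ 0`, does not change the predicate
  (`isHyperbolicWeilType_smul_iff`). The integer `d` of `φ ≫ φ = -(d • 𝟙 A)` plays no role
  (`K`-stability of a subspace is `φ`-stability) and is not an argument; `A.dim = 2 * n`,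
  `φ ≫ φ = -(d • 𝟙 A)`, rationality / ampleness / Weil-compatibility `φ^* h = d h` of `h` are
  hypotheses of the CONSUMERS' statements (as for `HodgeTheory.weilClassesOf`), so the predicate makes
  sense for every `(A, φ, n, h)`; for `n = 0` it is trivially true (empty frame,
  `isHyperbolicWeilType_zero`), and the exponent `2 * n - 1` is the only natural-number subtraction.
* Consumers: route `TateCuspKLift` of `HodgeConjecture` (informal crux `HyperbolicWeilCusps`: Weil
  classes `w ∈ weilClassesOf A φ n d` on hyperbolic components), `TropicalCuspLift`'s Witt-index
  dictionary, `WeilConeBoundary`-type statements.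
* Not here (no new named facts are introduced): Landherr's theorem `hyperbolic ⟺ det H = (-1)ⁿ`, the
  construction of `H₁(A, ℚ)` with its Riemann form and the resulting identification with
  `Motives.weilDiscriminant` (the tree has no Riemann form on `H₁(A(ℂ), ℚ)`), and the existence of the
  totally degenerate cusp.

## References

* [vanGeemen1994HodgeAV] B. van Geemen, LNM 1594 (1994), 4.14, Lemma 5.2 (1)–(6), 5.3–5.4, (5.4.1).
* [Markman2025SecantWeil] E. Markman, arXiv:2502.03415, §1.1 and Lemma 3.1.3.
* [LangeBirkenhake1992] H. Lange, Ch. Birkenhake, Complex Abelian Varieties (1992), Lemma 1.1.17,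
  Cor. 1.1.18, Thm. 1.2.4, Lemma 1.7.4.
* W. Landherr, Äquivalenz Hermitescher Formen über einem beliebigen algebraischen Zahlkörper, Abh.
  Math. Sem. Hamburg 11 (1936) (van Geemen's [L]; not used formally).
-/

noncomputable section

open CategoryTheory
open Literature.AlgebraicTopology.SingularHomology
open Literature.AlgebraicGeometry.HodgeTheory
open Literature.Geometry.Kaehler

universe u v

namespace Literature.AlgebraicGeometry.Motives

/-! ### Two pieces of linear algebra -/

/-- A bilinear map that vanishes on all pairs of members of a family `u` vanishes on the span of the
family in each variable. [folklore] -/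
theorem bilin_apply_eq_zero_of_mem_span {R M N : Type*} [CommSemiring R] [AddCommMonoid M]
    [Module R M] [AddCommMonoid N] [Module R N] {ι : Type*} (B : M →ₗ[R] M →ₗ[R] N) {u : ι → M}
    (hu : ∀ i j, B (u i) (u j) = 0) {x y : M} (hx : x ∈ Submodule.span R (Set.range u))
    (hy : y ∈ Submodule.span R (Set.range u)) : B x y = 0 := by
  have h1 : ∀ j, ∀ x ∈ Submodule.span R (Set.range u), B x (u j) = 0 := fun j x hx => by
    have hle : Submodule.span R (Set.range u) ≤ LinearMap.ker (B.flip (u j)) :=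
      Submodule.span_le.2 (Set.range_subset_iff.2 fun i => by
        simp only [SetLike.mem_coe, LinearMap.mem_ker, LinearMap.flip_apply, hu i j])
    simpa only [LinearMap.mem_ker, LinearMap.flip_apply] using hle hx
  have h2 : Submodule.span R (Set.range u) ≤ LinearMap.ker (B x) :=
    Submodule.span_le.2 (Set.range_subset_iff.2 fun j => by
      simp only [SetLike.mem_coe, LinearMap.mem_ker, h1 j x hx])
  simpa only [LinearMap.mem_ker] using h2 hy

/-- Rescaling the class rescales the iterated Lefschetz operator: `Lʲ_{c κ} = cʲ · Lʲ_κ`. [folklore] -/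
theorem lefschetzPow_smul {Y : Type u} [TopologicalSpace Y] {R : Type v} [CommRing R] (c : R)
    (κ : singularCohomology R R Y 2) (j k : ℕ) (a : singularCohomology R R Y k) :
    lefschetzPow (c • κ) j k a = c ^ j • lefschetzPow κ j k a := by
  induction j with
  | zero => simp
  | succ j ih =>
    simp only [lefschetzPow_succ, LinearMap.comp_apply, lefschetzOperator_apply, ih, map_smul,
      LinearMap.smul_apply, smul_smul]
    rw [← pow_succ]

/-! ### The polarization pairing on `H¹` -/

/-- The **polarization pairing in degree one** attached to a class `h ∈ H²(X(ℂ); ℂ)` and an exponent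
`j`: `Q_{h,j}(x, y) := hʲ ⌣ (x ⌣ y) ∈ H^{2+2j}(X(ℂ); ℂ)` for `x, y ∈ H¹(X(ℂ); ℂ)` — the `j`-th
Lefschetz iterate (`Literature.Geometry.Kaehler.lefschetzPow h j 2`, Voisin I §6.2.3) of the cup
product `x ⌣ y ∈ H²`. For an abelian variety `A` of dimension `g`, `j = g - 1` and `h = cl(E)` the
class of a polarization, `H^*(A) = ⋀^* H¹(A)` and `Q_{h,g-1}` is a non-zero multiple of the form dual
to the Riemann form `E` on `H₁(A, ℚ)`, with values in `H^{2g}(A(ℂ); ℂ) ≅ ℂ` (module docstring (3);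
Birkenhake–Lange, Lemma 1.1.17, Lemma 1.7.4). Defined for every `ℂ`-scheme `X`.
[cite: LangeBirkenhake1992, Lemma 1.1.17 and Lemma 1.7.4] -/
def polarizationPairingOne (X : SchemeOver ℂ) (h : complexBetti X 2) (j : ℕ) :
    complexBetti X 1 →ₗ[ℂ] complexBetti X 1 →ₗ[ℂ] complexBetti X (2 + 2 * j) :=
  (cupProduct (rfl : 1 + 1 = 2)).compr₂ (lefschetzPow h j 2)

/-- The defining formula `Q_{h,j}(x, y) = Lʲ_h (x ⌣ y)`. [folklore] -/
theorem polarizationPairingOne_apply (X : SchemeOver ℂ) (h : complexBetti X 2) (j : ℕ)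
    (x y : complexBetti X 1) :
    polarizationPairingOne X h j x y = lefschetzPow h j 2 (cupProduct (rfl : 1 + 1 = 2) x y) :=
  rfl

/-- Rescaling the polarization class: `Q_{c h, j} = cʲ · Q_{h, j}` (so for `c ≠ 0` the isotropic
subspaces do not change; a polarization class is only defined up to `ℚ^×_{>0}` anyway). [folklore] -/
theorem polarizationPairingOne_smul (X : SchemeOver ℂ) (c : ℂ) (h : complexBetti X 2) (j : ℕ)
    (x y : complexBetti X 1) :
    polarizationPairingOne X (c • h) j x y = c ^ j • polarizationPairingOne X h j x y :=
  lefschetzPow_smul c h j 2 _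

/-- Naturality of the polarization pairing under pull-back along a `ℂ`-morphism `f : X ⟶ Y`:
`f^* Q_{h,j}(x, y) = Q_{f^* h, j}(f^* x, f^* y)` (`f^*` is a ring homomorphism; Hatcher, Prop. 3.10).
[cite: HatcherAT2002, Prop. 3.10] -/
theorem map_polarizationPairingOne {X Y : SchemeOver ℂ} (f : X ⟶ Y) (h : complexBetti Y 2) (j : ℕ)
    (x y : complexBetti Y 1) :
    complexBetti.map f (2 + 2 * j) (polarizationPairingOne Y h j x y) =
      polarizationPairingOne X (complexBetti.map f 2 h) j (complexBetti.map f 1 x)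
        (complexBetti.map f 1 y) := by
  rw [polarizationPairingOne_apply, polarizationPairingOne_apply, complexBetti.map,
    complexBetti.map, complexBetti.map, lefschetzPow_map, cupProduct_map]

/-! ### Hyperbolic Weil type -/

/-- **`(A, φ)` is of hyperbolic Weil type in half-dimension `n` for the polarization class `h`**:
there are `2n` classes `u₁, …, u₂ₙ ∈ H¹(A(ℂ); ℂ)` which are rational (`IsRationalClass`),
`ℂ`-linearly independent, span a `φ^*`-stable subspace (`φ^* uᵢ ∈ ⟨u₁, …, u₂ₙ⟩_ℂ`), and are pairwise
isotropic for the polarization pairing, `h^{2n-1} ⌣ (uᵢ ⌣ uⱼ) = 0` for all `i, j` — i.e. `H¹(A, ℚ)`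
contains a `K`-stable `2n`-dimensional subspace Lagrangian for `(x, y) ↦ x ⌣ y ⌣ h^{2n-1}`.

Intended regime: `A.dim = 2n`, `φ ≫ φ = -(d • 𝟙 A)` with `d ≥ 1` (so `K = ℚ(√-d) ↪ End⁰(A)`,
`√-d ↦ φ`, of Weil type), `h` the (rational, ample) class of a polarization `E` with `φ^* h = d h`.
Then (module docstring) this says that `H₁(A, ℚ)` contains a `K`-stable `E`-Lagrangian `ℚ`-subspace
of dimension `2n`, i.e. that van Geemen's Hermitian form `H(x, y) = E(x, (√-d)·y) + √-d·E(x, y)` on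
the `K`-vector space `H₁(A, ℚ)` (Lemma 5.2 (2); the tree's `Motives.weilHermitianForm`), of signature
`(n, n)`, has Witt index `n` — is HYPERBOLIC — equivalently (Landherr; van Geemen 5.4, (5.4.1):
`det H = (-1)ⁿ a`) that its discriminant `det H ∈ ℚ^× / Nm(K^×)` (Lemma 5.2 (3); the tree's
`Motives.weilDiscriminant`) is the class of `(-1)ⁿ`: the component of the Weil locus through
`(A, K, E)` has a totally degenerate cusp. Vacuous (true) for `n = 0`; insensitive to `h ↦ c h`,
`c ≠ 0`. [cite: vanGeemen1994HodgeAV, Lemma 5.2 (2)–(3) and 5.4 (5.4.1)] -/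
def IsHyperbolicWeilType (A : AbelianVariety ℂ) (φ : A ⟶ A) (n : ℕ) (h : complexBetti A.X 2) :
    Prop :=
  ∃ u : Fin (2 * n) → complexBetti A.X 1,
    (∀ i, IsRationalClass (u i)) ∧ LinearIndependent ℂ u ∧
      (∀ i, complexBetti.map φ.hom.hom.hom 1 (u i) ∈ Submodule.span ℂ (Set.range u)) ∧
        ∀ i j, polarizationPairingOne A.X h (2 * n - 1) (u i) (u j) = 0

variable {A : AbelianVariety ℂ} {φ : A ⟶ A} {n : ℕ} {h : complexBetti A.X 2}

/-- Unfolding `IsHyperbolicWeilType` (definitional). [cite: vanGeemen1994HodgeAV, Lemma 5.2 and 5.4] -/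
theorem isHyperbolicWeilType_iff :
    IsHyperbolicWeilType A φ n h ↔
      ∃ u : Fin (2 * n) → complexBetti A.X 1,
        (∀ i, IsRationalClass (u i)) ∧ LinearIndependent ℂ u ∧
          (∀ i, complexBetti.map φ.hom.hom.hom 1 (u i) ∈ Submodule.span ℂ (Set.range u)) ∧
            ∀ i j, polarizationPairingOne A.X h (2 * n - 1) (u i) (u j) = 0 :=
  Iff.rfl

variable (A φ h) in
/-- The degenerate case `n = 0` holds vacuously (the empty frame). [folklore] -/
theorem isHyperbolicWeilType_zero : IsHyperbolicWeilType A φ 0 h :=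
  haveI : IsEmpty (Fin (2 * 0)) := ⟨fun i => Fin.elim0 i⟩
  ⟨fun i => Fin.elim0 i, fun i => Fin.elim0 i, linearIndependent_empty_type, fun i => Fin.elim0 i,
    fun i => Fin.elim0 i⟩

/-- A hyperbolic frame is isotropic on its whole span: `Q_h(x, y) = 0` for all `x, y` in the
`ℂ`-span of the `uᵢ` (bilinearity). [folklore] -/
theorem polarizationPairingOne_eq_zero_of_mem_span {u : Fin (2 * n) → complexBetti A.X 1}
    (hu : ∀ i j, polarizationPairingOne A.X h (2 * n - 1) (u i) (u j) = 0)
    {x y : complexBetti A.X 1} (hx : x ∈ Submodule.span ℂ (Set.range u))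
    (hy : y ∈ Submodule.span ℂ (Set.range u)) :
    polarizationPairingOne A.X h (2 * n - 1) x y = 0 :=
  bilin_apply_eq_zero_of_mem_span _ hu hx hy

/-- **Independence of the normalisation of the polarization class**: for `c ≠ 0`,
`IsHyperbolicWeilType A φ n (c • h) ↔ IsHyperbolicWeilType A φ n h` (`Q_{ch} = c^{2n-1} Q_h`).
[folklore] -/
theorem isHyperbolicWeilType_smul_iff {c : ℂ} (hc : c ≠ 0) :
    IsHyperbolicWeilType A φ n (c • h) ↔ IsHyperbolicWeilType A φ n h := by
  refine exists_congr fun u => and_congr_right fun _ => and_congr_right fun _ =>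
    and_congr_right fun _ => forall_congr' fun i => forall_congr' fun j => ?_
  rw [polarizationPairingOne_smul, smul_eq_zero, or_iff_right (pow_ne_zero _ hc)]

/-- The `φ^*`-stability of a frame propagates to its span: the span is mapped into itself by `φ^*`.
[folklore] -/
theorem map_mem_span_of_forall_map_mem {u : Fin (2 * n) → complexBetti A.X 1}
    (hu : ∀ i, complexBetti.map φ.hom.hom.hom 1 (u i) ∈ Submodule.span ℂ (Set.range u))
    {x : complexBetti A.X 1} (hx : x ∈ Submodule.span ℂ (Set.range u)) :
    complexBetti.map φ.hom.hom.hom 1 x ∈ Submodule.span ℂ (Set.range u) := by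
  have hle : Submodule.span ℂ (Set.range u) ≤
      (Submodule.span ℂ (Set.range u)).comap (complexBetti.map φ.hom.hom.hom 1).hom :=
    Submodule.span_le.2 (Set.range_subset_iff.2 fun i => hu i)
  exact hle hx

variable (A φ n h) in
/-- **Basis-free form.** `IsHyperbolicWeilType A φ n h` iff `H¹(A(ℂ); ℂ)` contains a `ℂ`-subspace
`L` which is defined over `ℚ` (spanned by its rational classes), has dimension `2n`, is
`φ^*`-stable, and is totally isotropic for the polarization pairing `Q_h = h^{2n-1} ⌣ (· ⌣ ·)` — the
literal "`H¹(A, ℚ)` contains a `K`-stable Lagrangian `ℚ`-subspace of dimension `2n`" (module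
docstring (1)–(4)). [cite: vanGeemen1994HodgeAV, Lemma 5.2 and 5.4] -/
theorem isHyperbolicWeilType_iff_exists_submodule :
    IsHyperbolicWeilType A φ n h ↔
      ∃ L : Submodule ℂ (complexBetti A.X 1),
        Submodule.span ℂ {c | c ∈ L ∧ IsRationalClass c} = L ∧
          Module.finrank ℂ L = 2 * n ∧
            (∀ c ∈ L, complexBetti.map φ.hom.hom.hom 1 c ∈ L) ∧
              ∀ x ∈ L, ∀ y ∈ L, polarizationPairingOne A.X h (2 * n - 1) x y = 0 := by
  constructor
  · rintro ⟨u, hrat, hind, hstab, hiso⟩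
    refine ⟨Submodule.span ℂ (Set.range u), ?_, ?_, fun c hc => map_mem_span_of_forall_map_mem hstab hc,
      fun x hx y hy => polarizationPairingOne_eq_zero_of_mem_span hiso hx hy⟩
    · refine le_antisymm (Submodule.span_le.2 fun c hc => hc.1) (Submodule.span_mono ?_)
      rintro _ ⟨i, rfl⟩
      exact ⟨Submodule.subset_span ⟨i, rfl⟩, hrat i⟩
    · rw [finrank_span_eq_card hind, Fintype.card_fin]
  · rintro ⟨L, hLrat, hLfin, hLstab, hLiso⟩
    rcases Nat.eq_zero_or_pos n with rfl | hn
    · exact isHyperbolicWeilType_zero A φ h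
    set s : Set (complexBetti A.X 1) := {c | c ∈ L ∧ IsRationalClass c} with hs
    obtain ⟨b, hbs, hbspan, hbind⟩ := exists_linearIndependent ℂ s
    have hbL : Submodule.span ℂ b = L := hbspan.trans hLrat
    haveI : Module.Finite ℂ L := Module.finite_of_finrank_pos (by omega)
    have hbmem : ∀ x : b, (x : complexBetti A.X 1) ∈ L := fun x =>
      hbL ▸ Submodule.subset_span x.2
    have hbind' : LinearIndependent ℂ (fun x : b => (⟨x, hbmem x⟩ : L)) :=
      LinearIndependent.of_comp L.subtype hbind
    haveI : Finite b := hbind'.finite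
    letI : Fintype b := Fintype.ofFinite b
    have hcard : Fintype.card b = 2 * n := by
      have h1 := finrank_span_eq_card hbind
      rw [Subtype.range_coe_subtype, Set.setOf_mem_eq, hbL, hLfin] at h1
      exact h1.symm
    let e : b ≃ Fin (2 * n) := Fintype.equivFinOfCardEq hcard
    have hrange : Set.range (fun i => ((e.symm i : b) : complexBetti A.X 1)) = b := by
      ext x
      constructor
      · rintro ⟨i, rfl⟩
        exact (e.symm i).2
      · intro hx
        exact ⟨e ⟨x, hx⟩, by simp only [Equiv.symm_apply_apply]⟩
    refine ⟨fun i => ((e.symm i : b) : complexBetti A.X 1), fun i => (hbs (e.symm i).2).2, ?_, ?_, ?_⟩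
    · exact hbind.comp e.symm e.symm.injective
    · intro i
      rw [hrange, hbL]
      exact hLstab _ (hbmem _)
    · intro i j
      exact hLiso _ (hbmem _) _ (hbmem _)

/-! ### The abstract side: isotropy for `H` is isotropy for `E` on `K`-subspaces -/

section Abstract

variable {K : Type*} [Field K] [Algebra ℚ K] {V : Type u} [AddCommGroup V] [Module ℚ V] [Module K V]

/-- `√-d ∉ ℚ`: an element `α` with `α² = -d`, `d > 0`, is not in the image of `ℚ` (squares of
rationals are non-negative). [folklore] -/
theorem not_mem_range_algebraMap_of_mul_self_eq_neg {α : K} {d : ℚ} (hd : 0 < d)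
    (hα : α * α = algebraMap ℚ K (-d)) : α ∉ Set.range (algebraMap ℚ K) := by
  rintro ⟨q, rfl⟩
  rw [← map_mul] at hα
  have hq : q * q = -d := (algebraMap ℚ K).injective hα
  nlinarith [mul_self_nonneg q]

/-- **`H`-isotropy of a `K`-subspace is `E`-isotropy** (van Geemen 1994, Lemma 5.2 (2): `H(x, y) =
E(x, α·y) + α·E(x, y)` with `E` rational-valued): for `α ∉ ℚ` (e.g. `α = √-d`,
`not_mem_range_algebraMap_of_mul_self_eq_neg`) and a `K`-subspace `W` (so `α·W ⊆ W`), van Geemen's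
Hermitian form `weilHermitianForm E α` vanishes identically on `W × W` iff `E` does. Hence a totally
`H`-isotropic `K`-subspace of `K`-dimension `n = ½ dim_K V` (Witt index `n`, `H` hyperbolic) is the
same thing as a `K`-stable `E`-Lagrangian `ℚ`-subspace — the abstract counterpart of
`IsHyperbolicWeilType`. [cite: vanGeemen1994HodgeAV, Lemma 5.2 (2)] -/
theorem forall_weilHermitianForm_eq_zero_iff (E : LinearMap.BilinForm ℚ V) {α : K}
    (hα : α ∉ Set.range (algebraMap ℚ K)) (W : Submodule K V) :
    (∀ x ∈ W, ∀ y ∈ W, weilHermitianForm E α x y = 0) ↔ ∀ x ∈ W, ∀ y ∈ W, E x y = 0 := by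
  constructor
  · intro hH x hx y hy
    have h := hH x hx y hy
    rw [weilHermitianForm_apply] at h
    by_contra hb
    refine hα ⟨-(E x (α • y)) / E x y, ?_⟩
    have hb' : algebraMap ℚ K (E x y) ≠ 0 :=
      (map_ne_zero_iff _ (algebraMap ℚ K).injective).2 hb
    rw [map_div₀, map_neg, div_eq_iff hb']
    linear_combination -h
  · intro hE x hx y hy
    rw [weilHermitianForm_apply, hE x hx (α • y) (W.smul_mem α hy), hE x hx y hy, map_zero,
      mul_zero, add_zero]

end Abstract

end Literature.AlgebraicGeometry.Motives

end
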